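import Literature.NumberTheory.Weil1964.AdicCompletionWeilIndexHilbertSymbol
import Literature.NumberTheory.Weil1964.LocalLerayCocycle
import HarnessLib

/-!
# At a finite place `K_v` of a number field the Leray cocycle is an eighth root of unity

Topic `NumberTheory/Weil1964`; namespace `Literature.NumberTheory.Weil1964`. KERNEL mathematics only (theorems; no
named fact, no `axiom`, no `sorry`). Joins `AdicCompletionWeilIndexHilbertSymbol.lean` (`weilIndex_pow_eight`:
`γ(a)⁸ = 1` in `K_v`, [Weil1964] Chap. II n° 28 p. 177) with `LocalLerayCocycle.lean` (the Leray / Perrin–Rao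
cocycle `c_ℓ(g₁, g₂) = μ_ψ(ℓ, g₁ℓ, g₁g₂ℓ)`).

[MoeglinVignerasWaldspurger1987, Chap. 3 §I.3, remarque b)]: "`c(g, g')` est une racine huitième de l'unité".
Over an abstract non-archimedean local field the tree proves `|c| = 1` (`norm_lerayCocycle`); at the completions
`K_v` of a number field `K` (the places at which [GelbartRogawski1991, §3.1] uses the cocycle) the Weil index of
every quadratic form — degenerate or not, on a coordinate or an abstract space — is an EIGHTH ROOT OF UNITY, hence
so are the Leray–Weil index `μ`, the cocycle `c` and the coboundaries relating different Lagrangians.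

The instance `[Invertible (2 : K_v)]` (characteristic `0`) is taken as an ARGUMENT, so the statements apply to
whatever instance a consumer has in scope.

## References

* [Weil1964] A. Weil, *Sur certains groupes d'opérateurs unitaires*, Acta Math. 111 (1964), Chap. II n° 28 p. 177.
* [MoeglinVignerasWaldspurger1987] C. Mœglin, M.-F. Vignéras, J.-L. Waldspurger, *Correspondances de Howe sur un
  corps p-adique*, LNM 1291 (1987), Chap. 3 §I.3, remarque b).
-/

set_option autoImplicit false

noncomputable section

open MeasureTheory Set NumberField IsDedekindDomain QuadraticMap
open scoped Classical

namespace Literature.NumberTheory.Weil1964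

variable (K : Type) [Field K] [NumberField K] (v : HeightOneSpectrum (𝓞 K))
variable [MeasurableSpace (v.adicCompletion K)] [BorelSpace (v.adicCompletion K)]
  (μ : Measure (v.adicCompletion K)) [μ.IsAddHaarMeasure] {ψ : AddChar (v.adicCompletion K) Circle}
  [Invertible (2 : v.adicCompletion K)]

omit [Invertible (2 : v.adicCompletion K)] in
/-- **`Π_{cᵢ ≠ 0} γ(cᵢ)` is an eighth root of unity in `K_v`** (each factor is, [Weil1964] n° 28).
[cite: Weil1964, Chap. II n° 28, p. 177] -/
theorem weilIndexDiag_pow_eight {ι : Type*} [Fintype ι] (hψ : ψ.IsContinuousNontrivial)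
    (c : ι → v.adicCompletion K) : weilIndexDiag ψ μ c ^ 8 = 1 := by
  rw [weilIndexDiag, ← Finset.prod_pow]
  exact Finset.prod_eq_one fun i _ => weilIndex_pow_eight K v μ hψ i.2

/-- **the Weil index of an ARBITRARY quadratic form on `K_v^ι` is an eighth root of unity**.
[cite: Weil1964, Chap. II n° 28, p. 177] -/
theorem weilIndexQF'_pow_eight {ι : Type*} [Fintype ι] (hψ : ψ.IsContinuousNontrivial)
    (Q : QuadraticForm (v.adicCompletion K) (ι → v.adicCompletion K)) : weilIndexQF' ψ μ Q ^ 8 = 1 := by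
  obtain ⟨c, A, hQA⟩ := exists_weightedSumSquares_linearEquiv' Q
  rw [weilIndexQF'_eq_weilIndexDiag μ hψ hQA]
  exact weilIndexDiag_pow_eight K v μ hψ c

/-- **the Weil index of a quadratic form on an abstract finite-dimensional `K_v`-space is an eighth root of unity**.
[cite: Weil1964, Chap. II n° 28, p. 177] -/
theorem weilIndexSpace_pow_eight {V : Type*} [AddCommGroup V] [Module (v.adicCompletion K) V]
    [FiniteDimensional (v.adicCompletion K) V] (hψ : ψ.IsContinuousNontrivial)
    (Q : QuadraticForm (v.adicCompletion K) V) : weilIndexSpace ψ μ Q ^ 8 = 1 :=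
  weilIndexQF'_pow_eight K v μ hψ _

variable {V : Type*} [AddCommGroup V] [Module (v.adicCompletion K) V] [FiniteDimensional (v.adicCompletion K) V]

/-- **the Leray–Maslov–Weil index `μ_ψ(ℓ₁, ℓ₂, ℓ₃)` over `K_v` is an eighth root of unity**.
[cite: MoeglinVignerasWaldspurger1987, Chap. 3 §I.3, remarque b)] -/
theorem lerayWeilIndex_pow_eight (hψ : ψ.IsContinuousNontrivial) (B : LinearMap.BilinForm (v.adicCompletion K) V)
    (ℓ₁ ℓ₂ ℓ₃ : Submodule (v.adicCompletion K) V) : lerayWeilIndex ψ μ B ℓ₁ ℓ₂ ℓ₃ ^ 8 = 1 :=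
  weilIndexSpace_pow_eight K v μ hψ _

/-- **"`c(g, g')` est une racine huitième de l'unité"**: the Leray (Perrin–Rao) cocycle over `K_v` satisfies
`c(g₁, g₂)⁸ = 1`. [cite: MoeglinVignerasWaldspurger1987, Chap. 3 §I.3, remarque b)] -/
theorem lerayCocycle_pow_eight (hψ : ψ.IsContinuousNontrivial) (B : LinearMap.BilinForm (v.adicCompletion K) V)
    (ℓ : Submodule (v.adicCompletion K) V) (g₁ g₂ : V ≃ₗ[v.adicCompletion K] V) :
    lerayCocycle ψ μ B ℓ g₁ g₂ ^ 8 = 1 :=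
  lerayWeilIndex_pow_eight K v μ hψ B _ _ _

/-- the bundled cocycle on `Sp(B)` takes values in the eighth roots of unity of `ℂˣ`.
[cite: MoeglinVignerasWaldspurger1987, Chap. 3 §I.3, remarque b)] -/
theorem lerayCentralCocycle_pow_eight (hψ : ψ.IsContinuousNontrivial)
    {B : LinearMap.BilinForm (v.adicCompletion K) V} (hB : LinearMap.IsAlt B) (hN : B.Nondegenerate)
    {ℓ : Submodule (v.adicCompletion K) V} (hℓ : B.orthogonal ℓ = ℓ)
    (g₁ g₂ : Literature.RepresentationTheory.HeisenbergGroup.Heisenberg.PseudoSymplectic.isometries B) :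
    lerayCentralCocycle μ hψ hB hN hℓ g₁ g₂ ^ 8 = 1 := by
  ext
  rw [Units.val_pow_eq_pow_val, lerayCentralCocycle_apply, Units.val_one]
  exact lerayCocycle_pow_eight K v μ hψ B ℓ _ _

end Literature.NumberTheory.Weil1964
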